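import Summits.RiemannHypothesis.RiemannHypothesis.Theorems.WeilFormatCKernelEnvelopePolar
import Summits.RiemannHypothesis.RiemannHypothesis.Theorems.WeilFormatCKernelEnvelopeArch
import HarnessLib

/-!
# Format C, design C∞: the KERNEL ENVELOPE of Yoshida's Gram matrix and of its sector kernels

Route context: Fourier–Galerkin / Schur-complement certificates of Weil positivity on a window ("format C";
cell memo `run/shared/lean/pub/rh-explicit/rh-explicit-weil-10/KERNEL-LEVER.md` §18 (the `Uq` clause of the deflated
certificate with limit data); supporting stmt-RiemannHypothesis-0098; seat rh-explicit-weil-10).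

The deflated certificate with infinite-range profiles (`sum_range_mul_mul_nonneg_of_certificate_deflated_limit`) needs
the finite-`P` coupling images to approximate the limit images UNIFORMLY in the truncation `N`.  By the kernel-row form of
the images (`WeilFormatCDeflatedFarImages`) this reduces to an ENVELOPE of the kernel, assembled here from the polar /
prime (`WeilFormatCKernelEnvelopePolar`) and archimedean (`WeilFormatCKernelEnvelopeArch`) parts:

* `exists_gramCoeff_envelope` (`a > 0`): `∃ C₀ C₁ ≥ 0`, `|G(n,m)| ≤ C₀/|n − m|` (`n ≠ m`) and
  `|G(n,n)| ≤ C₁ + log(1 + |n|)`, `G = gramCoeff a`;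
* `evenKernel_envelope`, `oddKernel_envelope`: the same shape of envelope for the EVEN kernel
  `M⁺(n,m) = [n = 0] G(0,m) ; [m = 0] G(n,0) ; (G(n,m) + G(n,−m))/2` and the ODD kernel
  `M⁻(k,l) = (G(k+1,l+1) − G(k+1,−(l+1)))/2` of any `G : ℤ → ℤ → ℝ` with such an envelope — the `ℕ`-indexed kernels
  the certificate theorems consume (`weilPositivityOn_of_sector_kernels_nonneg`);
* `exists_evenKernel_gramCoeff_envelope`, `exists_oddKernel_gramCoeff_envelope`: instantiated at `gramCoeff a`.

Elementary; standard axioms; no definitions; no RH claim.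
-/

set_option autoImplicit false
-- `Summit.RiemannHypothesis.RiemannHypothesis.…` is the layout-mandated namespace (summit = problem name).
set_option linter.dupNamespace false

noncomputable section

open Complex Finset
open scoped Real BigOperators ArithmeticFunction.vonMangoldt

namespace Summit.RiemannHypothesis.RiemannHypothesis.Theorems.WeilFormatC

open Literature.NumberTheory.LFunctions Literature.NumberTheory.LFunctions.Yoshida1992
open Literature.Analysis.SpecialFunctions Literature.Analysis.SpecialFunctions.Complex

variable {a : ℝ}

/-! ## The envelope of `gramCoeff` -/

/-- **Kernel envelope off the diagonal** (`a > 0`): `∃ C₀ ≥ 0`, `|G(n,m)| ≤ C₀/|n − m|` for all `n ≠ m`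
(`G = gramCoeff a` = polar + prime + archimedean, each `O(1/|n − m|)` off the diagonal). -/
theorem exists_abs_gramCoeff_le_of_ne (ha : 0 < a) :
    ∃ C₀ : ℝ, 0 ≤ C₀ ∧ ∀ n m : ℤ, n ≠ m → |gramCoeff a n m| ≤ C₀ / |(n : ℝ) - m| := by
  have hq : 0 < 1 - Real.exp (-(4 * a)) := by linarith [exp_neg_four_mul_lt_one ha]
  refine ⟨8 / π * (Real.exp (a / 2) - Real.exp (-(a / 2))) ^ 2 +
      2 / π * (∑ k ∈ weilPrimeIndex a, (Λ k : ℝ) / Real.sqrt k) +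
      (2 + π / 2 + 2 * (Real.exp (-a) / (1 - Real.exp (-(4 * a))))) / π, ?_, fun n m hnm ↦ ?_⟩
  · have hS := sum_vonMangoldt_div_sqrt_nonneg a
    have h3 : 0 ≤ (2 + π / 2 + 2 * (Real.exp (-a) / (1 - Real.exp (-(4 * a))))) / π := by positivity
    have h2 : 0 ≤ 2 / π * (∑ k ∈ weilPrimeIndex a, (Λ k : ℝ) / Real.sqrt k) := mul_nonneg (by positivity) hS
    have h1 : 0 ≤ 8 / π * (Real.exp (a / 2) - Real.exp (-(a / 2))) ^ 2 := by positivity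
    linarith
  have hgap : 0 < |(n : ℝ) - m| := by
    rw [abs_pos, sub_ne_zero]
    exact_mod_cast hnm
  have h1 := abs_polarCoeff_le_of_ne ha hnm
  have h2 := abs_primeCoeff_le_of_ne a hnm
  have h3 := abs_archCoeff_le_of_ne ha hnm
  unfold gramCoeff
  rw [add_div, add_div]
  exact (abs_add_le _ _).trans (add_le_add ((abs_add_le _ _).trans (add_le_add h1 h2)) h3)

/-- **Kernel envelope on the diagonal** (`a > 0`): `∃ C₁ ≥ 0`, `|G(n,n)| ≤ C₁ + log(1 + |n|)` for all `n`. -/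
theorem exists_abs_gramCoeff_diag_le (ha : 0 < a) :
    ∃ C₁ : ℝ, 0 ≤ C₁ ∧ ∀ n : ℤ, |gramCoeff a n n| ≤ C₁ + Real.log (1 + |(n : ℝ)|) := by
  obtain ⟨C, hC0, hC⟩ := exists_abs_archCoeff_diag_le ha
  refine ⟨16 / a * (Real.exp (a / 2) - Real.exp (-(a / 2))) ^ 2 +
      2 * (∑ k ∈ weilPrimeIndex a, (Λ k : ℝ) / Real.sqrt k) + C, ?_, fun n ↦ ?_⟩
  · have hS := sum_vonMangoldt_div_sqrt_nonneg a
    have h1 : 0 ≤ 16 / a * (Real.exp (a / 2) - Real.exp (-(a / 2))) ^ 2 := by positivity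
    linarith
  have h1 := abs_polarCoeff_diag_le ha n
  have h2 := abs_primeCoeff_diag_le ha n
  have h3 := hC n
  unfold gramCoeff
  have t := (abs_add_le _ _).trans (add_le_add ((abs_add_le _ _).trans (add_le_add h1 h2)) h3)
  linarith

/-- **The kernel envelope of Yoshida's Gram matrix** (`a > 0`): there are `C₀, C₁ ≥ 0` with
`|G(n,m)| ≤ C₀/|n − m|` for `n ≠ m` and `|G(n,n)| ≤ C₁ + log(1 + |n|)`, `G = gramCoeff a`
((5.15)/(5.16): the polar term is `O(1/((1+|n|)(1+|m|)))`, the prime and archimedean off-diagonal terms carry the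
printed `1/(π(n − m))` with bounded numerators, the diagonal `Re ψ(¼ + iω_n/2)` is `log|n| + O(1)`). -/
theorem exists_gramCoeff_envelope (ha : 0 < a) :
    ∃ C₀ C₁ : ℝ, 0 ≤ C₀ ∧ 0 ≤ C₁ ∧
      (∀ n m : ℤ, n ≠ m → |gramCoeff a n m| ≤ C₀ / |(n : ℝ) - m|) ∧
      (∀ n : ℤ, |gramCoeff a n n| ≤ C₁ + Real.log (1 + |(n : ℝ)|)) := by
  obtain ⟨C₀, hC₀, h₀⟩ := exists_abs_gramCoeff_le_of_ne ha
  obtain ⟨C₁, hC₁, h₁⟩ := exists_abs_gramCoeff_diag_le ha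
  exact ⟨C₀, C₁, hC₀, hC₁, h₀, h₁⟩

/-! ## The envelope of the sector kernels -/

/-- **Even sector kernel envelope.**  If `|G(n,m)| ≤ C₀/|n − m|` (`n ≠ m`) and `|G(n,n)| ≤ C₁ + C₂ log(1 + |n|)` on `ℤ`,
then the even kernel `M⁺(n,m) = [n = 0] G(0,m) ; [m = 0] G(n,0) ; (G(n,m) + G(n,−m))/2` on `ℕ` satisfies
`|M⁺(n,m)| ≤ C₀/|n − m|` (`n ≠ m`) and `|M⁺(n,n)| ≤ (C₁ + C₀) + C₂ log(1 + n)`. -/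
theorem evenKernel_envelope (G : ℤ → ℤ → ℝ) {C₀ C₁ C₂ : ℝ} (hC₀ : 0 ≤ C₀)
    (hoff : ∀ n m : ℤ, n ≠ m → |G n m| ≤ C₀ / |(n : ℝ) - m|)
    (hdiag : ∀ n : ℤ, |G n n| ≤ C₁ + C₂ * Real.log (1 + |(n : ℝ)|)) :
    (∀ n m : ℕ, n ≠ m →
      |(if n = 0 then G 0 m else if m = 0 then G n 0 else (G n m + G n (-(m : ℤ))) / 2)| ≤ C₀ / |(n : ℝ) - m|) ∧
    (∀ n : ℕ, |(if n = 0 then G 0 n else if n = 0 then G n 0 else (G n n + G n (-(n : ℤ))) / 2)|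
      ≤ (C₁ + C₀) + C₂ * Real.log (1 + n)) := by
  constructor
  · intro n m hnm
    have hgap : 0 < |(n : ℝ) - m| := by
      rw [abs_pos, sub_ne_zero]
      exact_mod_cast hnm
    by_cases hn : n = 0
    · subst hn
      rw [if_pos rfl]
      have h := hoff 0 m (by exact_mod_cast hnm)
      simpa using h
    by_cases hm : m = 0
    · subst hm
      rw [if_neg hn, if_pos rfl]
      have h := hoff n 0 (by exact_mod_cast hn)
      simpa using h
    rw [if_neg hn, if_neg hm]
    have h1 := hoff n m (by exact_mod_cast hnm)
    have h2 := hoff n (-(m : ℤ)) (by omega)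
    push_cast at h1 h2
    rw [sub_neg_eq_add] at h2
    have hsum : |(n : ℝ) - m| ≤ |(n : ℝ) + m| := by
      rw [abs_of_nonneg (by positivity : (0 : ℝ) ≤ n + m)]
      calc |(n : ℝ) - m| ≤ |(n : ℝ)| + |(m : ℝ)| := abs_sub _ _
        _ = n + m := by rw [Nat.abs_cast, Nat.abs_cast]
    have h2' : |G n (-(m : ℤ))| ≤ C₀ / |(n : ℝ) - m| :=
      h2.trans (div_le_div_of_nonneg_left hC₀ hgap hsum)
    calc |(G n m + G n (-(m : ℤ))) / 2| = |G n m + G n (-(m : ℤ))| / 2 := by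
          rw [abs_div, abs_of_pos (by norm_num : (0 : ℝ) < 2)]
      _ ≤ (C₀ / |(n : ℝ) - m| + C₀ / |(n : ℝ) - m|) / 2 :=
          div_le_div_of_nonneg_right ((abs_add_le _ _).trans (add_le_add h1 h2')) (by norm_num)
      _ = C₀ / |(n : ℝ) - m| := by ring
  · intro n
    have hlog : 0 ≤ Real.log (1 + (n : ℝ)) := Real.log_nonneg (by linarith [Nat.cast_nonneg (α := ℝ) n])
    by_cases hn : n = 0
    · subst hn
      rw [if_pos rfl]
      have h := hdiag 0
      simp only [Int.cast_zero, abs_zero, add_zero, Real.log_one, mul_zero] at h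
      simp only [Nat.cast_zero, add_zero, Real.log_one, mul_zero]
      linarith
    rw [if_neg hn, if_neg hn]
    have h1 := hdiag n
    have h2 := hoff n (-(n : ℤ)) (by omega)
    push_cast at h1 h2
    rw [Nat.abs_cast] at h1
    rw [sub_neg_eq_add, abs_of_nonneg (by positivity : (0 : ℝ) ≤ n + n)] at h2
    have hn1 : (1 : ℝ) ≤ n := by exact_mod_cast Nat.one_le_iff_ne_zero.2 hn
    have h2' : |G n (-(n : ℤ))| ≤ C₀ := h2.trans (by
      rw [div_le_iff₀ (by positivity)]
      nlinarith)
    calc |(G n n + G n (-(n : ℤ))) / 2| = |G n n + G n (-(n : ℤ))| / 2 := by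
          rw [abs_div, abs_of_pos (by norm_num : (0 : ℝ) < 2)]
      _ ≤ (C₁ + C₂ * Real.log (1 + n) + C₀) / 2 :=
          div_le_div_of_nonneg_right ((abs_add_le _ _).trans (add_le_add h1 h2')) (by norm_num)
      _ ≤ (C₁ + C₀) + C₂ * Real.log (1 + n) := by
          have : 0 ≤ C₁ + C₂ * Real.log (1 + n) := (abs_nonneg _).trans h1
          have hC0' : 0 ≤ C₀ := hC₀
          linarith

/-- **Odd sector kernel envelope.**  Under the same hypotheses the odd kernel
`M⁻(k,l) = (G(k+1,l+1) − G(k+1,−(l+1)))/2` on `ℕ` satisfies `|M⁻(k,l)| ≤ C₀/|k − l|` (`k ≠ l`) and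
`|M⁻(k,k)| ≤ (C₁ + C₀) + C₂ log(2 + k)`. -/
theorem oddKernel_envelope (G : ℤ → ℤ → ℝ) {C₀ C₁ C₂ : ℝ} (hC₀ : 0 ≤ C₀)
    (hoff : ∀ n m : ℤ, n ≠ m → |G n m| ≤ C₀ / |(n : ℝ) - m|)
    (hdiag : ∀ n : ℤ, |G n n| ≤ C₁ + C₂ * Real.log (1 + |(n : ℝ)|)) :
    (∀ k l : ℕ, k ≠ l →
      |(G ((k : ℤ) + 1) ((l : ℤ) + 1) - G ((k : ℤ) + 1) (-((l : ℤ) + 1))) / 2| ≤ C₀ / |(k : ℝ) - l|) ∧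
    (∀ k : ℕ, |(G ((k : ℤ) + 1) ((k : ℤ) + 1) - G ((k : ℤ) + 1) (-((k : ℤ) + 1))) / 2|
      ≤ (C₁ + C₀) + C₂ * Real.log (2 + k)) := by
  constructor
  · intro k l hkl
    have hgap : 0 < |(k : ℝ) - l| := by
      rw [abs_pos, sub_ne_zero]
      exact_mod_cast hkl
    have h1 := hoff ((k : ℤ) + 1) ((l : ℤ) + 1) (by omega)
    have h2 := hoff ((k : ℤ) + 1) (-((l : ℤ) + 1)) (by omega)
    push_cast at h1 h2
    rw [show ((k : ℝ) + 1 - ((l : ℝ) + 1)) = (k : ℝ) - l by ring] at h1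
    rw [show ((k : ℝ) + 1 - -((l : ℝ) + 1)) = (k : ℝ) + l + 2 by ring] at h2
    have hsum : |(k : ℝ) - l| ≤ |(k : ℝ) + l + 2| := by
      rw [abs_of_nonneg (by positivity : (0 : ℝ) ≤ k + l + 2)]
      calc |(k : ℝ) - l| ≤ |(k : ℝ)| + |(l : ℝ)| := abs_sub _ _
        _ = k + l := by rw [Nat.abs_cast, Nat.abs_cast]
        _ ≤ k + l + 2 := by linarith
    have h2' : |G ((k : ℤ) + 1) (-((l : ℤ) + 1))| ≤ C₀ / |(k : ℝ) - l| :=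
      h2.trans (div_le_div_of_nonneg_left hC₀ hgap hsum)
    calc |(G ((k : ℤ) + 1) ((l : ℤ) + 1) - G ((k : ℤ) + 1) (-((l : ℤ) + 1))) / 2|
        = |G ((k : ℤ) + 1) ((l : ℤ) + 1) - G ((k : ℤ) + 1) (-((l : ℤ) + 1))| / 2 := by
          rw [abs_div, abs_of_pos (by norm_num : (0 : ℝ) < 2)]
      _ ≤ (C₀ / |(k : ℝ) - l| + C₀ / |(k : ℝ) - l|) / 2 :=
          div_le_div_of_nonneg_right ((abs_sub _ _).trans (add_le_add h1 h2')) (by norm_num)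
      _ = C₀ / |(k : ℝ) - l| := by ring
  · intro k
    have h1 := hdiag ((k : ℤ) + 1)
    have h2 := hoff ((k : ℤ) + 1) (-((k : ℤ) + 1)) (by omega)
    push_cast at h1 h2
    rw [abs_of_nonneg (by positivity : (0 : ℝ) ≤ k + 1), show (1 : ℝ) + (k + 1) = 2 + k by ring] at h1
    rw [show ((k : ℝ) + 1 - -((k : ℝ) + 1)) = 2 * ((k : ℝ) + 1) by ring,
      abs_of_nonneg (by positivity : (0 : ℝ) ≤ 2 * ((k : ℝ) + 1))] at h2
    have h2' : |G ((k : ℤ) + 1) (-((k : ℤ) + 1))| ≤ C₀ := h2.trans (by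
      rw [div_le_iff₀ (by positivity)]
      nlinarith [Nat.cast_nonneg (α := ℝ) k])
    calc |(G ((k : ℤ) + 1) ((k : ℤ) + 1) - G ((k : ℤ) + 1) (-((k : ℤ) + 1))) / 2|
        = |G ((k : ℤ) + 1) ((k : ℤ) + 1) - G ((k : ℤ) + 1) (-((k : ℤ) + 1))| / 2 := by
          rw [abs_div, abs_of_pos (by norm_num : (0 : ℝ) < 2)]
      _ ≤ (C₁ + C₂ * Real.log (2 + k) + C₀) / 2 :=
          div_le_div_of_nonneg_right ((abs_sub _ _).trans (add_le_add h1 h2')) (by norm_num)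
      _ ≤ (C₁ + C₀) + C₂ * Real.log (2 + k) := by
          have : 0 ≤ C₁ + C₂ * Real.log (2 + k) := (abs_nonneg _).trans h1
          linarith

/-- **Even sector kernel envelope of Yoshida's matrix** (`a > 0`): `∃ C₀ C₁ ≥ 0` with `|M⁺(n,m)| ≤ C₀/|n − m|`
(`n ≠ m`) and `|M⁺(n,n)| ≤ C₁ + log(1 + n)`, `M⁺` the even kernel of `gramCoeff a` (as consumed by
`weilPositivityOn_of_sector_kernels_nonneg`). -/
theorem exists_evenKernel_gramCoeff_envelope (ha : 0 < a) :
    ∃ C₀ C₁ : ℝ, 0 ≤ C₀ ∧ 0 ≤ C₁ ∧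
      (∀ n m : ℕ, n ≠ m →
        |(if n = 0 then gramCoeff a 0 m else if m = 0 then gramCoeff a n 0
          else (gramCoeff a n m + gramCoeff a n (-(m : ℤ))) / 2)| ≤ C₀ / |(n : ℝ) - m|) ∧
      (∀ n : ℕ, |(if n = 0 then gramCoeff a 0 n else if n = 0 then gramCoeff a n 0
          else (gramCoeff a n n + gramCoeff a n (-(n : ℤ))) / 2)| ≤ C₁ + Real.log (1 + n)) := by
  obtain ⟨C₀, C₁, hC₀, hC₁, h₀, h₁⟩ := exists_gramCoeff_envelope ha
  have h := evenKernel_envelope (gramCoeff a) (C₂ := 1) hC₀ h₀ (fun n ↦ by rw [one_mul]; exact h₁ n)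
  refine ⟨C₀, C₁ + C₀, hC₀, add_nonneg hC₁ hC₀, h.1, fun n ↦ ?_⟩
  have := h.2 n
  rw [one_mul] at this
  exact this

/-- **Odd sector kernel envelope of Yoshida's matrix** (`a > 0`): `∃ C₀ C₁ ≥ 0` with `|M⁻(k,l)| ≤ C₀/|k − l|`
(`k ≠ l`) and `|M⁻(k,k)| ≤ C₁ + log(1 + k)`, `M⁻(k,l) = (G(k+1,l+1) − G(k+1,−(l+1)))/2`, `G = gramCoeff a`. -/
theorem exists_oddKernel_gramCoeff_envelope (ha : 0 < a) :
    ∃ C₀ C₁ : ℝ, 0 ≤ C₀ ∧ 0 ≤ C₁ ∧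
      (∀ k l : ℕ, k ≠ l →
        |(gramCoeff a ((k : ℤ) + 1) ((l : ℤ) + 1) - gramCoeff a ((k : ℤ) + 1) (-((l : ℤ) + 1))) / 2|
          ≤ C₀ / |(k : ℝ) - l|) ∧
      (∀ k : ℕ, |(gramCoeff a ((k : ℤ) + 1) ((k : ℤ) + 1) - gramCoeff a ((k : ℤ) + 1) (-((k : ℤ) + 1))) / 2|
          ≤ C₁ + Real.log (1 + k)) := by
  obtain ⟨C₀, C₁, hC₀, hC₁, h₀, h₁⟩ := exists_gramCoeff_envelope ha
  have h := oddKernel_envelope (gramCoeff a) (C₂ := 1) hC₀ h₀ (fun n ↦ by rw [one_mul]; exact h₁ n)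
  refine ⟨C₀, C₁ + C₀ + Real.log 2, hC₀,
    add_nonneg (add_nonneg hC₁ hC₀) (Real.log_nonneg (by norm_num)), h.1, fun k ↦ ?_⟩
  have h2 := h.2 k
  rw [one_mul] at h2
  have hk : (0 : ℝ) ≤ k := Nat.cast_nonneg k
  have hlog : Real.log (2 + k) ≤ Real.log 2 + Real.log (1 + k) := by
    rw [← Real.log_mul (by norm_num) (by positivity)]
    exact Real.log_le_log (by positivity) (by nlinarith)
  linarith

end Summit.RiemannHypothesis.RiemannHypothesis.Theorems.WeilFormatC

end
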